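import Literature.Probability.RandomPlanarGeometry.SLEBoundaryHitting
import Literature.Probability.RandomPlanarGeometry.LoewnerRealPointProofs
import Literature.Probability.RandomPlanarGeometry.CritPercSLEProofs
import Literature.Topology.PlaneTopology.HalfPlaneEnclosure
import Literature.Topology.PlaneTopology.JordanCurveProofs
import HarnessLib

/-!
# Swallowing of real points by SLE_κ = hitting of real rays by the trace (proof of the reduction)

This file proves the named fact `Literature.Probability.RandomPlanarGeometry.sle_swallowingTime_ofReal_eq_firstHit` of
`Literature.Probability.RandomPlanarGeometry.SLEBoundaryHitting` — for every sample path of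
chordal SLE_κ in `ℍ` (driving function `W = √κ B(ω)`, continuous, `W 0 = 0`) whose Loewner chain
is generated by the curve `γ`, and every real `x ≠ 0`, the swallowing time `T_x` (lifetime of the
real Loewner flow `ġ = 2/(g - W)` from `x`) equals the first time `γ` hits the closed real ray
`realRay x` from `x` pointing away from `0`: `Literature.Probability.RandomPlanarGeometry.sle_swallowingTime_ofReal_eq_firstHit_holds`.
The proof uses three proved inputs of the tree:

1. Lawler's real-point statement `Literature.Probability.RandomPlanarGeometry.Loewner.lt_swallowingTime_of_notMem_closure_hull_holds`
   (`LoewnerRealPointProofs`; Lawler (2005), Ch. 4 §4.1 p. 96 and Rem. 6.6: a real point outside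
   the closed hull `K̄_t` is still flowing at time `t`, by Schwarz reflection);
2. the strict growth of hulls `Literature.Probability.RandomPlanarGeometry.Loewner.hull_ne_hull` (`LoewnerMapProofs`, from
   `hull_ssubset_hull` of `LoewnerGrowth`: Lawler (2005), Thm. 4.6, `hcap(K_t) = 2t`);
3. the Jordan curve theorem `Literature.Topology.PlaneTopology.JordanCurveTheorem_holds`
   (`Literature.Topology.PlaneTopology.JordanCurveProofs`), through the enclosure lemma
   `Literature.Topology.PlaneTopology.JordanCurveTheorem.exists_isBounded_connectedComponentIn` of
   `Literature.Topology.PlaneTopology.HalfPlaneEnclosure`.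

Main results: `Literature.Probability.RandomPlanarGeometry.Loewner.swallowingTime_ofReal_eq_firstHit_of_pos` (general continuous
driving function started at `0`, `x > 0`), `…_of_ne` (both signs, by the reflection `z ↦ -z̄`),
the by-product `Literature.Probability.RandomPlanarGeometry.Loewner.IsGeneratedByCurve.image_Icc_subset_closure_hull` (`γ[0,t] ⊆ K̄_t`
for `t > 0`, from strict growth), the discharge `Literature.Probability.RandomPlanarGeometry.sle_swallowingTime_ofReal_eq_firstHit_holds`,
and its consequence for **Cardy's formula for SLE₆**,
`Literature.Probability.RandomPlanarGeometry.sle_six_measureReal_hitsBefore_of_stochasticFacts`: the target statement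
`CritPerc.sle_six_measureReal_hitsBefore` of `CritPercSLE` from the two remaining stochastic
inputs, Lawler's Prop. 6.33 (`sle_measureReal_swallowingTime_lt`) and a.s. swallowing of
positive reals for `κ > 4` (`sle_swallows_real_iff`, Rohde–Schramm Lemma 6.5), through
`CritPerc.sle_six_measureReal_hitsBefore_of_jordanCurveTheorem` of `CritPercSLEProofs`.

## Proof (Lawler (2005), Rem. 6.6: `T_x = inf{t : x ∈ K̄_t}`; for a chain generated by `γ`,
`x ∈ K̄_t` iff `γ[0,t]` meets the ray)

Let `x > 0` and `t_* = inf{t : γ(t) ∈ [x, ∞)}`.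
* `t_* ≤ T_x`: for `t < t_*`, `γ[0, t]` misses the closed ray, hence misses a `δ`-neighbourhood
  `S` of it in `ℍₒ`; `S` is convex and unbounded, so each of its points has an unbounded
  component in `ℍₒ ∖ γ[0, t]`, i.e. `S ∩ K_t = ∅`; thus `x ∉ K̄_t` and `t < T_x` by input 1.
* `T_x ≤ t_*`: if `t_* < T_x`, a ball around `x` misses `K_{t_*}` (lower semicontinuity of
  `z ↦ T_z`, `Loewner.isOpen_setOf_lt_swallowingTime`). If `γ(t_*) > x`, the enclosure lemma
  (input 2) for the continuum `γ[0, t_*] ∌ x` joining `0` to `γ(t_*)` puts the points `x + iε`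
  in `K_{t_*}`, contradiction. If `γ(t_*) = x`, then either `γ` visits `ℍₒ` at times `s ↑ t_*`,
  and `γ(s) ∈ K_{t_*}` close to `x`, contradiction; or `γ` is real on an interval `[t₁, t_*]`,
  so `K_{t₁} = K_{t_*}`, contradicting strict growth (`hull_ne_hull`).
* `x < 0`: reflect (`Loewner.swallowingTime_neg_ofReal`, `Loewner.IsGeneratedByCurve.neg_conj`,
  `firstHit_negConj_realRay`).

## Mathlib

We USE `Disjoint.exists_thickenings`, `Metric.thickening`, `Convex.thickening`,
`convex_halfSpace_im_gt/_le/_ge`, `convex_halfSpace_re_ge`,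
`IsPreconnected.subset_connectedComponentIn`, `exists_Ioc_subset_of_mem_nhds`, `exists_between`
in `WithTop ℝ≥0`; hitting times through `Literature.Probability.RandomPlanarGeometry.firstHit` (= Mathlib's `MeasureTheory.hittingAfter`,
see `SLEBoundaryHitting`).

## References

* G. F. Lawler, *Conformally Invariant Processes in the Plane*, AMS Math. Surveys 114 (2005),
  Ch. 4 §4.1 (p. 96, Thm. 4.6, Lemma 4.13), Remark 6.6 (p. 148).
-/

noncomputable section

namespace Literature.Probability.RandomPlanarGeometry

open Set Filter _root_.Topology Metric
open UpperHalfPlane (upperHalfPlaneSet isOpen_upperHalfPlaneSet)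
open scoped NNReal ComplexConjugate

/-! ### Real rays and first hitting times: elementary facts -/

section Elementary

/-- For `x > 0` the real ray from `x` is `{im = 0, x ≤ re} = [x, ∞)`. [folklore] -/
theorem mem_realRay_iff_of_pos {x : ℝ} (hx : 0 < x) {z : ℂ} :
    z ∈ realRay x ↔ z.im = 0 ∧ x ≤ z.re := by
  rw [mem_realRay_iff]
  exact ⟨fun ⟨h1, h2, _⟩ ↦ ⟨h1, h2 hx⟩,
    fun ⟨h1, h2⟩ ↦ ⟨h1, fun _ ↦ h2, fun h ↦ absurd hx (not_lt.2 h.le)⟩⟩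

/-- For `x > 0` the real ray `[x, ∞)` is convex. [folklore] -/
theorem convex_realRay_of_pos {x : ℝ} (hx : 0 < x) : Convex ℝ (realRay x) := by
  have : realRay x = ({z : ℂ | z.im ≤ 0} ∩ {z : ℂ | 0 ≤ z.im}) ∩ {z : ℂ | x ≤ z.re} := by
    ext z
    simp only [mem_realRay_iff_of_pos hx, mem_inter_iff, mem_setOf_eq]
    constructor
    · rintro ⟨h1, h2⟩; exact ⟨⟨h1.le, h1.ge⟩, h2⟩
    · rintro ⟨⟨h1, h2⟩, h3⟩; exact ⟨le_antisymm h1 h2, h3⟩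
  rw [this]
  exact ((convex_halfSpace_im_le 0).inter (convex_halfSpace_im_ge 0)).inter
    (convex_halfSpace_re_ge x)

/-- The reflection `z ↦ -z̄` exchanges the rays from `x` and from `-x`. [folklore] -/
theorem negConj_mem_realRay_iff {x : ℝ} {z : ℂ} : -conj z ∈ realRay (-x) ↔ z ∈ realRay x := by
  simp only [mem_realRay_iff, Complex.neg_im, Complex.conj_im, neg_neg, Complex.neg_re,
    Complex.conj_re, neg_pos, neg_lt_zero, neg_le_neg_iff]
  tauto

/-- First hitting times only depend on the hitting set of times. [folklore] -/
theorem firstHit_congr {γ γ' : ℝ≥0 → ℂ} {S S' : Set ℂ} (h : ∀ t, γ t ∈ S ↔ γ' t ∈ S') :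
    firstHit γ S = firstHit γ' S' := by
  unfold firstHit
  have : {t : ℝ≥0 | γ t ∈ S} = {t | γ' t ∈ S'} := by ext t; exact h t
  rw [this]

/-- The first hitting time of `realRay x` by `γ` is that of `realRay (-x)` by `-γ̄`. [folklore] -/
theorem firstHit_negConj_realRay (γ : ℝ≥0 → ℂ) (x : ℝ) :
    firstHit (fun t ↦ -conj (γ t)) (realRay (-x)) = firstHit γ (realRay x) :=
  firstHit_congr fun _ ↦ negConj_mem_realRay_iff

/-- In `WithTop ℝ≥0`: if every finite time below `a` is below `b`, then `a ≤ b`. [folklore] -/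
theorem WithTop.le_of_forall_coe_lt {a b : WithTop ℝ≥0}
    (h : ∀ t : ℝ≥0, (t : WithTop ℝ≥0) < a → (t : WithTop ℝ≥0) < b) : a ≤ b := by
  by_contra hba
  rw [not_le] at hba
  obtain ⟨c, hbc, hca⟩ := exists_between hba
  obtain ⟨t, rfl⟩ := WithTop.ne_top_iff_exists.1 (ne_top_of_lt hca)
  exact lt_irrefl b (hbc.trans (h t hca))

/-- Before the first hitting time of `S`, the initial segment `γ[0, t]` misses `S`. [folklore] -/
theorem image_Icc_disjoint_of_lt_firstHit {γ : ℝ≥0 → ℂ} {S : Set ℂ} {t : ℝ≥0}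
    (h : (t : WithTop ℝ≥0) < firstHit γ S) : Disjoint (γ '' Icc 0 t) S := by
  rw [Set.disjoint_left]
  rintro _ ⟨s, hs, rfl⟩ hγs
  exact notMem_of_lt_firstHit (lt_of_le_of_lt (WithTop.coe_le_coe.2 hs.2) h) hγs

end Elementary

/-! ### Swallowing of real points = hitting of real rays -/

namespace Loewner

variable {W : ℝ≥0 → ℝ} {γ : ℝ≥0 → ℂ}

/-- For a chain generated by `γ`: a point of `ℍₒ` off `γ[0, t]` lies in the hull `K_t` iff its
connected component in `ℍₒ ∖ γ[0, t]` is bounded. [cite: Lawler2005, Ch. 4 §4.1] -/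
theorem IsGeneratedByCurve.mem_hull_iff (h : IsGeneratedByCurve W γ) {t : ℝ≥0} {z : ℂ}
    (hz : z ∈ upperHalfPlaneSet) (hzγ : z ∉ γ '' Icc 0 t) :
    z ∈ hull W t ↔
      Bornology.IsBounded (connectedComponentIn (upperHalfPlaneSet \ γ '' Icc 0 t) z) := by
  rw [h.hull_eq t]
  constructor
  · rintro ⟨-, hzu⟩
    by_contra hb
    exact hzu ⟨⟨hz, hzγ⟩, hb⟩
  · intro hb
    exact ⟨hz, fun hzu ↦ hzu.2 hb⟩

/-- For a chain generated by `γ`: points of `γ[0, t]` in `ℍₒ` lie in the hull `K_t`.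
[cite: Lawler2005, Ch. 4 §4.1] -/
theorem IsGeneratedByCurve.mem_hull_of_mem_image (h : IsGeneratedByCurve W γ) {t : ℝ≥0} {z : ℂ}
    (hz : z ∈ upperHalfPlaneSet) (hzγ : z ∈ γ '' Icc 0 t) : z ∈ hull W t := by
  rw [h.hull_eq t]
  exact ⟨hz, fun hu ↦ hu.1.2 hzγ⟩

/-- If the curve stays on the real axis during `[t₁, t]`, the hull does not grow:
`K_t = K_{t₁}`. [cite: Lawler2005, Ch. 4 §4.1] -/
theorem IsGeneratedByCurve.hull_eq_hull_of_im_eq_zero (h : IsGeneratedByCurve W γ) {t₁ t : ℝ≥0}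
    (ht : t₁ ≤ t) (hreal : ∀ s, t₁ ≤ s → s ≤ t → (γ s).im = 0) : hull W t = hull W t₁ := by
  rw [h.hull_eq t, h.hull_eq t₁]
  congr 2
  ext z
  constructor
  · rintro ⟨hz, hzγ⟩
    exact ⟨hz, fun hmem ↦ hzγ (image_mono (Icc_subset_Icc le_rfl ht) hmem)⟩
  · rintro ⟨hz, hzγ⟩
    refine ⟨hz, ?_⟩
    rintro ⟨s, hs, rfl⟩
    rcases le_or_gt s t₁ with hs₁ | hs₁
    · exact hzγ ⟨s, ⟨hs.1, hs₁⟩, rfl⟩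
    · have := hreal s hs₁.le hs.2
      exact (ne_of_gt (show 0 < (γ s).im from hz)) this

/-- **The curve lies in the closed hull**: for a Loewner chain generated by `γ` with continuous
driving function and `0 < t`, `γ[0, t] ⊆ K̄_t`. Points of the curve in `ℍₒ` are in the hull;
if `γ(v) ∈ ℝ` for some `v < t`, the curve cannot stay real on a time interval after `v` (the
hull would not grow, `hull_eq_hull_of_im_eq_zero`, contradicting the strict growth
`hull_ne_hull`), so `γ(v)` is a limit of points `γ(s) ∈ ℍₒ ∩ K_t`, `s ↓ v`; and `γ(t)` is the
limit of `γ(v)`, `v ↑ t`. Lawler (2005), Ch. 4 §4.1. [cite: Lawler2005, Ch. 4 §4.1] -/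
theorem IsGeneratedByCurve.image_Icc_subset_closure_hull (hW : Continuous W)
    (h : IsGeneratedByCurve W γ) {t : ℝ≥0} (ht : 0 < t) :
    γ '' Icc 0 t ⊆ closure (hull W t) := by
  -- first the points `γ v`, `v < t`
  have key : ∀ v : ℝ≥0, v < t → γ v ∈ closure (hull W t) := by
    intro v hvt
    by_cases hv : 0 < (γ v).im
    · exact subset_closure (h.mem_hull_of_mem_image hv ⟨v, ⟨zero_le, hvt.le⟩, rfl⟩)
    · have hreal : (γ v).im = 0 := le_antisymm (not_lt.1 hv) (h.im_nonneg v)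
      rw [Metric.mem_closure_iff]
      intro ε hε
      -- a time `s ∈ (v, t]` close to `v` with `γ s ∈ ℍₒ`
      obtain ⟨δ, hδ, hδε⟩ := Metric.continuous_iff.1 h.continuous v ε hε
      set d : ℝ≥0 := ⟨δ / 2, by positivity⟩ with hd
      have hdpos : 0 < d := NNReal.coe_pos.1 (show (0 : ℝ) < δ / 2 by positivity)
      set u : ℝ≥0 := min t (v + d) with hu
      have hvu : v < u := lt_min hvt (lt_add_of_pos_right v hdpos)
      have hut : u ≤ t := min_le_left _ _
      obtain ⟨s, hvs, hsu, hs⟩ : ∃ s, v ≤ s ∧ s ≤ u ∧ 0 < (γ s).im := by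
        by_contra hcon
        push Not at hcon
        have hreal' : ∀ s, v ≤ s → s ≤ u → (γ s).im = 0 := fun s hvs hsu ↦
          le_antisymm (hcon s hvs hsu) (h.im_nonneg s)
        exact hull_ne_hull hW hvu (h.hull_eq_hull_of_im_eq_zero hvu.le hreal').symm
      refine ⟨γ s, hull_mono W hut (h.mem_hull_of_mem_image hs ⟨s, ⟨zero_le, hsu⟩, rfl⟩), ?_⟩
      rw [dist_comm]
      refine hδε s ?_
      have hsv : ((v : ℝ≥0) : ℝ) ≤ s := by exact_mod_cast hvs
      have hsu' : ((s : ℝ≥0) : ℝ) ≤ u := by exact_mod_cast hsu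
      have hu' : ((u : ℝ≥0) : ℝ) ≤ v + δ / 2 := by
        have h1 : u ≤ v + d := min_le_right _ _
        have h2 : ((u : ℝ≥0) : ℝ) ≤ ((v + d : ℝ≥0) : ℝ) := by exact_mod_cast h1
        have h3 : ((d : ℝ≥0) : ℝ) = δ / 2 := rfl
        rw [NNReal.coe_add, h3] at h2
        exact h2
      rw [NNReal.dist_eq, abs_of_nonneg (by linarith)]
      linarith
  rintro _ ⟨v, hv, rfl⟩
  rcases lt_or_eq_of_le hv.2 with hvt | rfl
  · exact key v hvt
  · -- `γ t` is a limit of `γ v`, `v ↑ t`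
    have hcont : ContinuousWithinAt γ (Iio v) v := h.continuous.continuousWithinAt
    have hne : (𝓝[Iio v] v).NeBot := by
      refine mem_closure_iff_nhdsWithin_neBot.1 ?_
      rw [closure_Iio' (show (Iio v).Nonempty from ⟨0, ht⟩)]
      exact self_mem_Iic
    refine isClosed_closure.mem_of_tendsto hcont.tendsto ?_
    filter_upwards [self_mem_nhdsWithin] with s hs
    exact key s hs

/-- **Swallowing of positive real points = hitting of the ray `[x, ∞)`** for a Loewner chain
generated by a curve `γ` with continuous driving function started at `0`, using the Jordan
curve theorem (`JordanCurveTheorem_holds`, through the enclosure lemma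
`JordanCurveTheorem.exists_isBounded_connectedComponentIn`), Lawler's real-point statement
`lt_swallowingTime_of_notMem_closure_hull_holds` (a real point outside `K̄_t` is still flowing)
and the strict growth of hulls (`hull_ne_hull`). For `x > 0`,
`T_x = inf{t : γ(t) ∈ [x, ∞)}` (Lawler (2005), Rem. 6.6: `T_x = inf{t : x ∈ K̄_t}`, and for a
chain generated by `γ`, `x ∈ K̄_t` iff `γ[0, t]` meets `[x, ∞)`).

Proof. (`≥`) If `t` is before the first hit, `γ[0, t]` misses the closed ray, so a
`δ`-neighbourhood `S` of the ray in `ℍₒ` (convex, unbounded) misses `γ[0, t]`; every point of `S`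
has an unbounded component, so `S ∩ K_t = ∅`, `x ∉ K̄_t`, and `t < T_x` by Lawler's statement.
(`≤`) If the first hit `t₀` were `< T_x`, a ball around `x` would miss `K_{t₀}` (lower
semicontinuity of `T_z`). If `γ(t₀) > x`, the enclosure lemma applied to `C = γ[0, t₀] ∌ x`
(joining `0` to `γ(t₀)`) puts points `x + iε` in `K_{t₀}`: contradiction. If `γ(t₀) = x`, either
`γ` has points of `ℍₒ` arbitrarily close to `x` before `t₀` — these are in `K_{t₀}`,
contradiction — or `γ` is real on an interval `[t₁, t₀]`, so `K_{t₁} = K_{t₀}`, contradicting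
strict growth. [cite: Lawler2005, Rem. 6.6] -/
theorem swallowingTime_ofReal_eq_firstHit_of_pos (hW : Continuous W) (hW0 : W 0 = 0)
    (hγ : IsGeneratedByCurve W γ) {x : ℝ} (hx : 0 < x) :
    swallowingTime W x = firstHit γ (realRay x) := by
  have hx0 : (x : ℂ) ≠ W 0 := by
    rw [hW0]; exact_mod_cast hx.ne'
  have hγ0 : γ 0 = 0 := by rw [hγ.apply_zero, hW0]; simp
  apply le_antisymm
  · -- `T_x ≤ firstHit`
    by_contra hlt
    rw [not_le] at hlt
    obtain ⟨t₀, ht₀, hγt₀⟩ :=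
      exists_firstHit_eq_coe hγ.continuous (isClosed_realRay x) (ne_top_of_lt hlt)
    rw [ht₀] at hlt
    -- a ball around `x` missing `K_{t₀}`
    obtain ⟨r, hr, hball⟩ := Metric.isOpen_iff.1 (isOpen_setOf_lt_swallowingTime hW t₀) x hlt
    have hK : ∀ z ∈ ball (x : ℂ) r, z ∉ hull W t₀ := fun z hz hzK ↦
      absurd hzK.2 (not_le.2 (hball hz))
    obtain ⟨hyim, hyre⟩ := (mem_realRay_iff_of_pos hx).1 hγt₀
    have ht₀0 : 0 < t₀ := by
      refine pos_iff_ne_zero.2 fun h0 ↦ ?_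
      rw [h0, hγ0] at hyre
      simp only [Complex.zero_re] at hyre
      linarith
    rcases eq_or_lt_of_le hyre with hyx | hyx
    · -- `γ t₀ = x`
      have hγx : γ t₀ = x := Complex.ext (by simp [← hyx]) (by simp [hyim])
      by_cases hcase : ∀ t₁ < t₀, ∃ s, t₁ < s ∧ s < t₀ ∧ 0 < (γ s).im
      · -- points of `ℍₒ` on the curve near `x`
        have hcont := hγ.continuous.continuousAt (x := t₀)
        rw [ContinuousAt, hγx, Metric.tendsto_nhds] at hcont
        have hev := hcont r hr
        obtain ⟨l, hl, hsub⟩ := exists_Ioc_subset_of_mem_nhds hev ⟨0, ht₀0⟩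
        obtain ⟨s, hls, hst₀, hsim⟩ := hcase l hl
        have hs : dist (γ s) x < r := hsub ⟨hls, hst₀.le⟩
        refine hK (γ s) hs (hγ.mem_hull_of_mem_image hsim ⟨s, ⟨zero_le, hst₀.le⟩, rfl⟩)
      · -- the curve is real on an interval `[t₁, t₀]`: the hull does not grow
        push Not at hcase
        obtain ⟨t₁, ht₁, hreal⟩ := hcase
        set t₂ : ℝ≥0 := (t₁ + t₀) / 2 with ht₂
        have ht₁₂ : t₁ < t₂ := by
          rw [ht₂, ← NNReal.coe_lt_coe, NNReal.coe_div, NNReal.coe_add]; push_cast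
          have := NNReal.coe_lt_coe.2 ht₁; linarith
        have ht₂₀ : t₂ < t₀ := by
          rw [ht₂, ← NNReal.coe_lt_coe, NNReal.coe_div, NNReal.coe_add]; push_cast
          have := NNReal.coe_lt_coe.2 ht₁; linarith
        have hreal' : ∀ s, t₂ ≤ s → s ≤ t₀ → (γ s).im = 0 := by
          intro s hs2 hs0
          rcases eq_or_lt_of_le hs0 with h0 | h0
          · rw [h0]; exact hyim
          · exact le_antisymm (hreal s (ht₁₂.trans_le hs2) h0) (hγ.im_nonneg s)
        exact hull_ne_hull hW ht₂₀ (hγ.hull_eq_hull_of_im_eq_zero ht₂₀.le hreal').symm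
    · -- `γ t₀ > x`: the enclosure lemma
      set C : Set ℂ := γ '' Icc 0 t₀ with hC
      have hCc : IsCompact C := (isCompact_Icc).image hγ.continuous
      have hCconn : IsPreconnected C := (isPreconnected_Icc).image _ hγ.continuous.continuousOn
      have hCim : ∀ w ∈ C, 0 ≤ w.im := by
        rintro _ ⟨s, -, rfl⟩; exact hγ.im_nonneg s
      have h0C : ((0 : ℝ) : ℂ) ∈ C := ⟨0, ⟨le_rfl, zero_le⟩, by rw [hγ0]; simp⟩
      have hbC : (((γ t₀).re : ℝ) : ℂ) ∈ C :=
        ⟨t₀, ⟨zero_le, le_rfl⟩, Complex.ext (by simp) (by simp [hyim])⟩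
      have hxC : (x : ℂ) ∉ C := by
        rintro ⟨s, hs, hsx⟩
        rcases eq_or_lt_of_le hs.2 with h | h
        · rw [h] at hsx
          have := congrArg Complex.re hsx
          simp only [Complex.ofReal_re] at this
          linarith
        · have hlt' : ((s : ℝ≥0) : WithTop ℝ≥0) < firstHit γ (realRay x) := by
            rw [ht₀]; exact WithTop.coe_lt_coe.2 h
          exact notMem_of_lt_firstHit hlt' (hsx ▸ ofReal_mem_realRay x)
      obtain ⟨r', hr', henc⟩ :=
        Literature.Topology.PlaneTopology.JordanCurveTheorem_holds.exists_isBounded_connectedComponentIn hCc hCconn hCim hx hyx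
          h0C hbC hxC
      -- the test point `x + i ρ`
      set ρ : ℝ := min r r' / 2 with hρ
      have hρ0 : 0 < ρ := by rw [hρ]; positivity
      have hρr : ρ < r := by
        have := min_le_left r r'; rw [hρ]; linarith
      have hρr' : ρ < r' := by
        have := min_le_right r r'; rw [hρ]; linarith
      set z : ℂ := ⟨x, ρ⟩ with hz
      have hzim : 0 < z.im := hρ0
      have hdist : dist z x = ρ := by
        rw [Complex.dist_of_re_eq (by simp [hz]), hz, Complex.ofReal_im, Real.dist_eq, sub_zero,
          abs_of_pos hρ0]
      have hzr : z ∈ ball (x : ℂ) r := by rw [mem_ball, hdist]; exact hρr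
      have hzr' : z ∈ ball (x : ℂ) r' := by rw [mem_ball, hdist]; exact hρr'
      have hzC : z ∉ C := fun h ↦ hK z hzr (hγ.mem_hull_of_mem_image hzim h)
      exact hK z hzr ((hγ.mem_hull_iff hzim hzC).2 (henc z hzr' hzim))
  · -- `firstHit ≤ T_x`
    refine WithTop.le_of_forall_coe_lt fun t ht ↦ ?_
    -- `γ[0, t]` misses the closed ray; thicken
    obtain ⟨δ, hδ, hdisj⟩ := (image_Icc_disjoint_of_lt_firstHit ht).exists_thickenings
      ((isCompact_Icc).image hγ.continuous) (isClosed_realRay x)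
    set S : Set ℂ := thickening δ (realRay x) ∩ upperHalfPlaneSet with hS
    have hSconv : Convex ℝ S := ((convex_realRay_of_pos hx).thickening δ).inter
      (convex_halfSpace_im_gt 0)
    have hSsub : S ⊆ upperHalfPlaneSet \ γ '' Icc 0 t := fun w hw ↦ ⟨hw.2, fun hwγ ↦
      Set.disjoint_left.1 hdisj (self_subset_thickening hδ _ hwγ) hw.1⟩
    have hSunb : ¬ Bornology.IsBounded S := by
      intro hb
      obtain ⟨R, hR⟩ := hb.subset_closedBall 0
      set w : ℂ := ⟨x + |R| + 1, δ / 2⟩ with hw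
      have hwS : w ∈ S := by
        refine ⟨mem_thickening_iff.2 ⟨((x + |R| + 1 : ℝ) : ℂ), ?_, ?_⟩, show 0 < w.im by
          simp [hw]; positivity⟩
        · exact (mem_realRay_iff_of_pos hx).2 ⟨Complex.ofReal_im _, by
            simp only [Complex.ofReal_re]; linarith [abs_nonneg R]⟩
        · rw [Complex.dist_of_re_eq (by simp [hw]), hw, Complex.ofReal_im, Real.dist_eq, sub_zero,
            abs_of_pos (by positivity)]
          linarith
      have h1 := hR hwS
      rw [mem_closedBall, dist_zero_right] at h1
      have h2 : w.re ≤ ‖w‖ := Complex.re_le_norm w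
      simp only [hw] at h2
      linarith [le_abs_self R]
    have hSK : ∀ w ∈ S, w ∉ hull W t := by
      intro w hw hwK
      rw [hγ.hull_eq t] at hwK
      refine hwK.2 ⟨hSsub hw, fun hb ↦ hSunb (hb.subset ?_)⟩
      exact hSconv.isPreconnected.subset_connectedComponentIn hw hSsub
    -- `x ∉ closure K_t`
    have hxK : (x : ℂ) ∉ closure (hull W t) := by
      rw [Metric.mem_closure_iff]
      push Not
      refine ⟨δ, hδ, fun w hwK ↦ ?_⟩
      by_contra hlt
      rw [not_le] at hlt
      refine hSK w ⟨mem_thickening_iff.2 ⟨x, ofReal_mem_realRay x, ?_⟩, hwK.1⟩ hwK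
      rwa [dist_comm] at hlt
    exact lt_swallowingTime_of_notMem_closure_hull_holds hW hx0 hxK

/-- **Swallowing of real points = hitting of real rays**, both signs: for `x ≠ 0`,
`T_x = inf{t : γ(t) ∈ realRay x}` (the case `x < 0` follows from `x > 0` by the reflection
`z ↦ -z̄`, `W ↦ -W`: `swallowingTime_neg_ofReal`, `IsGeneratedByCurve.neg_conj`,
`firstHit_negConj_realRay`).
[cite: Lawler2005, Rem. 6.6] -/
theorem swallowingTime_ofReal_eq_firstHit_of_ne (hW : Continuous W) (hW0 : W 0 = 0)
    (hγ : IsGeneratedByCurve W γ)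
    {x : ℝ} (hx : x ≠ 0) :
    swallowingTime W x = firstHit γ (realRay x) := by
  rcases lt_or_gt_of_ne hx with hneg | hpos
  · rw [← swallowingTime_neg_ofReal W x, ← firstHit_negConj_realRay γ x]
    exact swallowingTime_ofReal_eq_firstHit_of_pos hW.neg (by simp [hW0]) hγ.neg_conj
      (neg_pos.2 hneg)
  · exact swallowingTime_ofReal_eq_firstHit_of_pos hW hW0 hγ hpos

end Loewner

/-- **Discharge of `Literature.Probability.RandomPlanarGeometry.sle_swallowingTime_ofReal_eq_firstHit`** (`SLEBoundaryHitting`; Lawler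
(2005), Rem. 6.6): for every sample path of SLE_κ (driving function `√κ B(ω)`, continuous and
started at `0`) whose chain is generated by `γ`, swallowing of a real point `x ≠ 0` is hitting of
`realRay x` by `γ` (`Loewner.swallowingTime_ofReal_eq_firstHit_of_ne`).
[cite: Lawler2005, Rem. 6.6] -/
theorem sle_swallowingTime_ofReal_eq_firstHit_holds : sle_swallowingTime_ofReal_eq_firstHit :=
  fun κ ω _ hγ _ hx ↦
  Loewner.swallowingTime_ofReal_eq_firstHit_of_ne (continuous_sleDriving κ ω) (sleDriving_zero κ ω)
    hγ hx

/-- **Cardy's formula for SLE₆ in a conformal rectangle from the two stochastic facts.** The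
target statement `CritPerc.sle_six_measureReal_hitsBefore` of `CritPercSLE` (Werner (2007), §3
p. 19; Lawler (2005), Prop. 6.33 at `κ = 6`) follows from
`CritPerc.sle_six_measureReal_hitsBefore_of_jordanCurveTheorem` (`CritPercSLEProofs`) with its
inputs "swallowing = hitting of real rays" (`sle_swallowingTime_ofReal_eq_firstHit_holds`,
Lawler Rem. 6.6) and the Jordan curve theorem (`JordanCurveTheorem_holds`) now proved. The whole
deterministic side (Loewner flow, conformal maps, strict growth, Schwarz reflection at real
points, plane topology, boundary correspondence, Cardy–Carathéodory transport, the `κ = 6`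
hypergeometric identity) is thereby proved; the remaining literature inputs are the two
stochastic ones — Lawler's Prop. 6.33 (`h₁`, `sle_measureReal_swallowingTime_lt`: Itô calculus
for the Loewner flow, `P{T_{-y} > T_1}` is the hypergeometric function) and a.s. swallowing of
positive reals for `κ > 4` (`h₃`, `sle_swallows_real_iff` of `ItoProcesses`, Rohde–Schramm
(2005), Lemma 6.5, a Bessel-process dichotomy). [cite: Lawler2005, Prop. 6.33] -/
theorem sle_six_measureReal_hitsBefore_of_stochasticFacts
    (h₁ : sle_measureReal_swallowingTime_lt) (h₃ : Literature.Analysis.FunctionSpaces.sle_swallows_real_iff) :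
    RandomPlanarGeometry.sle_six_measureReal_hitsBefore :=
  RandomPlanarGeometry.sle_six_measureReal_hitsBefore_of_jordanCurveTheorem h₁
    sle_swallowingTime_ofReal_eq_firstHit_holds h₃ Literature.Topology.PlaneTopology.JordanCurveTheorem_holds

end Literature.Probability.RandomPlanarGeometry
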